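import Summits.Ventures.PercRepro.ThetaOmegaAntiSame

/-!
# The third-member credits at an edge

Dossier proofs/MINE1-theoremS.md, Addendum 80 suppl. 1 (ii) (mine-1, gen 41). Let `s` and `s + q`
be members of `F` (an edge of the family in direction `q`) and `w` a further member. Beyond the
edge family's own credit (`omegaCount_qEdges_le_credit`), `w` gives a `q`-edge of the `A`- or
`C`-family of `F` under one colour coincidence on each end of the edge:

* `q ∈ w` and `c0 w = c0 s = c0 (s + q)`: the meet edge `(s ⊓ w, (s + q) ⊓ w)` in `A`;
* `q ∈ w` and `c0 w = c1 s = c1 (s + q)`: the difference edge `(w \ (s + q), w \ s)` in `A`;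
* `q ∉ w` and `c1 w = c1 s = c1 (s + q)`: the co-join edge `(U \ ((s + q) ⊔ w), U \ (s ⊔ w))` in `C`;
* `q ∉ w` and `c1 w = c0 s = c0 (s + q)`: the difference edge `(s \ w, (s + q) \ w)` in `A`.

Consequently (`stuck_of_no_third_credit`), a point whose credit has NO third-member edge forces
the colourings to be constant on each side: with `s` `c0`-consistent across the edge
(`c0 s = c0 (s + q) = γ`) every other `q`-member has `c0 ≠ γ` and every other `q`-free member has
`c1 ≠ γ`; with `s` `c1`-consistent (`c1 s = c1 (s + q) = δ`) every other `q`-member has `c0 ≠ δ`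
and every other `q`-free member has `c1 ≠ δ` — the «near-constant colourings» of the addendum.
-/

namespace PercRepro.MSTight

open Finset

variable {α : Type*} [DecidableEq α]

section Third

variable {q : α} {U : Finset α} {F : Finset (Finset α)} {c0 c1 : Finset α → Bool}
  {s w : Finset α}

/-- **Meet edge from a third member containing `q`.** -/
theorem inf_mem_qEdges_omegaA_of_third (hs : s ∈ F) (hqs : q ∉ s) (hsq : insert q s ∈ F)
    (hw : w ∈ F) (hqw : q ∈ w) (hws : w ≠ s) (hwsq : w ≠ insert q s)
    (h0 : c0 w = c0 s) (h0' : c0 w = c0 (insert q s)) :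
    s ⊓ w ∈ qEdges q (omegaA F c0 c1) := by
  rw [mem_qEdges]
  refine ⟨inf_mem_omegaA (Ne.symm hws) hs hw h0.symm, ?_, ?_⟩
  · simp only [inf_eq_inter, mem_inter, not_and]
    exact fun h => absurd h hqs
  · rw [insert_inf_of_mem hqw]
    exact inf_mem_omegaA (Ne.symm hwsq) hsq hw h0'.symm

/-- **Difference edge from a third member containing `q`** (`c0 w = c1` of both ends). -/
theorem sdiff_mem_qEdges_omegaA_of_third_mem (hs : s ∈ F) (hqs : q ∉ s) (hsq : insert q s ∈ F)
    (hw : w ∈ F) (hqw : q ∈ w) (h1 : c0 w = c1 s) (h1' : c0 w = c1 (insert q s)) :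
    w \ insert q s ∈ qEdges q (omegaA F c0 c1) := by
  rw [mem_qEdges]
  refine ⟨sdiff_mem_omegaA hw hsq h1', ?_, ?_⟩
  · simp only [mem_sdiff, mem_insert, true_or, not_true_eq_false, and_false, not_false_eq_true]
  · rw [insert_sdiff_insert_of_mem hqw hqs]
    exact sdiff_mem_omegaA hw hs h1

/-- **Co-join edge from a third member avoiding `q`** (`c1 w = c1` of both ends). -/
theorem sdiff_sup_mem_qEdges_omegaC_of_third (hq : q ∈ U) (hs : s ∈ F) (hqs : q ∉ s)
    (hsq : insert q s ∈ F) (hw : w ∈ F) (hqw : q ∉ w) (hws : w ≠ s) (hwsq : w ≠ insert q s)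
    (h1 : c1 w = c1 s) (h1' : c1 w = c1 (insert q s)) :
    U \ (insert q s ⊔ w) ∈ qEdges q (omegaC U F c1) := by
  rw [mem_qEdges]
  refine ⟨sdiff_sup_mem_omegaC (Ne.symm hwsq) hsq hw h1'.symm, ?_, ?_⟩
  · simp only [mem_sdiff, sup_eq_union, mem_union, mem_insert, true_or, not_true_eq_false,
      and_false, not_false_eq_true]
  · rw [sdiff_insert_sup_eq, insert_sdiff_erase_sup hq hqs hqw]
    exact sdiff_sup_mem_omegaC (Ne.symm hws) hs hw h1.symm

/-- **Difference edge from a third member avoiding `q`** (`c1 w = c0` of both ends). -/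
theorem sdiff_mem_qEdges_omegaA_of_third_notMem (hs : s ∈ F) (hqs : q ∉ s) (hsq : insert q s ∈ F)
    (hw : w ∈ F) (hqw : q ∉ w) (h0 : c1 w = c0 s) (h0' : c1 w = c0 (insert q s)) :
    s \ w ∈ qEdges q (omegaA F c0 c1) := by
  rw [mem_qEdges]
  refine ⟨sdiff_mem_omegaA hs hw h0.symm, ?_, ?_⟩
  · simp only [mem_sdiff, not_and]
    exact fun h => absurd h hqs
  · rw [← insert_sdiff_of_notMem' hqw]
    exact sdiff_mem_omegaA hsq hw h0'.symm

/-- **A point without third-member credit has near-constant colourings**: if the credit at `q`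
vanishes and `s, s + q` are members, then every further `q`-member `w` has `c0 w` different
from every colour that is consistent across the edge, and every further `q`-free member `w`
has `c1 w` different from them. -/
theorem colours_of_credit_eq_zero (hq : q ∈ U) (hs : s ∈ F) (hqs : q ∉ s) (hsq : insert q s ∈ F)
    (hcred : (qEdges q (omegaA F c0 c1)).card + (qEdges q (omegaC U F c1)).card = 0)
    (hw : w ∈ F) (hws : w ≠ s) (hwsq : w ≠ insert q s) :
    (q ∈ w → (c0 s = c0 (insert q s) → c0 w ≠ c0 s) ∧ (c1 s = c1 (insert q s) → c0 w ≠ c1 s)) ∧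
      (q ∉ w → (c1 s = c1 (insert q s) → c1 w ≠ c1 s) ∧ (c0 s = c0 (insert q s) → c1 w ≠ c0 s)) := by
  have hA : ∀ d, d ∉ qEdges q (omegaA F c0 c1) := by
    intro d hd
    have := card_pos.2 ⟨d, hd⟩
    omega
  have hC : ∀ d, d ∉ qEdges q (omegaC U F c1) := by
    intro d hd
    have := card_pos.2 ⟨d, hd⟩
    omega
  refine ⟨fun hqw => ⟨fun hc h => ?_, fun hc h => ?_⟩, fun hqw => ⟨fun hc h => ?_, fun hc h => ?_⟩⟩
  · exact hA _ (inf_mem_qEdges_omegaA_of_third hs hqs hsq hw hqw hws hwsq h (h.trans hc))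
  · exact hA _ (sdiff_mem_qEdges_omegaA_of_third_mem hs hqs hsq hw hqw h (h.trans hc))
  · exact hC _ (sdiff_sup_mem_qEdges_omegaC_of_third hq hs hqs hsq hw hqw hws hwsq h (h.trans hc))
  · exact hA _ (sdiff_mem_qEdges_omegaA_of_third_notMem hs hqs hsq hw hqw h (h.trans hc))

end Third

end PercRepro.MSTight
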